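import Summits.BirchSwinnertonDyer.BirchSwinnertonDyer.Theses.LeadingTerm
import Summits.BirchSwinnertonDyer.BirchSwinnertonDyer.Theorems.PinchPrime.Negative.ConsequencesOfCrux
import Summits.BirchSwinnertonDyer.BirchSwinnertonDyer.Theorems.LeadingTermPinchPrimeCofiniteIMC
import Summits.BirchSwinnertonDyer.BirchSwinnertonDyer.Theorems.LeadingTermPinchPrimeCofiniteTorsion
import Literature.NumberTheory.EllipticCurves.IwasawaLeadingTerm
import Literature.NumberTheory.EllipticCurves.IwasawaOrderKernelRankProofs
import Literature.NumberTheory.EllipticCurves.SelmerCorankHolds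
import Literature.NumberTheory.EllipticCurves.IwasawaSelmerDualProofs
import Literature.NumberTheory.EllipticCurves.SelmerInftyTorsionFiniteProofs
import Literature.NumberTheory.EllipticCurves.KatoRankBoundProofs
import Literature.NumberTheory.EllipticCurves.ComplexMultiplication
import Literature.NumberTheory.EllipticCurves.ModPIrreducibleCofinite
import Literature.NumberTheory.EllipticCurves.PAdicBSD

/-!
# BirchSwinnertonDyer / LeadingTerm — crux `PinchPrime` (stmt-BirchSwinnertonDyer-16218),
# line `SketchIdeator2`, stub `stub_openStubs_of_L_one_ne_zero` (KNOWN SLICE: the line's two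
# OPEN stubs hold for every curve with `L(E, 1) ≠ 0`, modulo Kato's finiteness theorem and the
# three named facts)

Registered stub of the lead skeleton `Cruxes/PinchPrime/Lines/SketchIdeator2.lean` (v10). The
line reduces the crux to two OPEN stubs — (A) `Ш(E/ℚ)[p^∞]` finite cofinitely in `p`, (B) `T`
semisimple at `0` on `ℚ_p ⊗ X(E/ℚ_∞)` at infinitely many good ordinary `p ≥ 5` with the
normalised cyclotomic datum — plus named facts. This file certifies the only fully known regime:
for `E/ℚ` with `L(E, 1) ≠ 0` both (A) and (B) HOLD, curve by curve, modulo
* Kato's finiteness theorem `kato_finite_of_L_one_ne_zero` (Kato 2004, Cor. 14.3: `L(E,1) ≠ 0 ⟹`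
  `E(ℚ)` and `Ш(E/ℚ)[p^∞]` finite, every `p`) — hypothesis, asked at every prime;
* modularity `exists_isNewformOf`, BCS `burungale_castella_skinner_charIdeal_eq_padicLFunction`
  and the control fact `Greenberg1999_coinvariantsRank_eq_selmerCorank_rat` — hypotheses.

Proof. (A) with `B = ∅` is Kato. (B): `E(ℚ)` finite gives `rank = 0`
(`mordellWeilRank_eq_zero_of_finite`) and `L(E,1) ≠ 0` gives `r_an = 0`
(`analyticRank_eq_zero_of_entireLFunction_one_ne_zero`), so at EVERY good ordinary `p ≥ 5`
`ord_T L_p(f, α_p) = 0 = rank` by the interpolation `L_p(0) = (1 - α⁻¹)² L(E,1)/Ω⁺`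
(`pinch_iff_analyticRank_eq_zero_of_rank_eq_zero`, PROVED in the tree); outside the IMC- and
torsion-exceptional finite sets (`stub_cofiniteIMC` p131521, `stub_cofiniteTorsion` p133139) this
gives `ord_T f_E = rank`, and the corank squeeze `rank ≤ corank Sel = rank X/TX ≤ ord_T f_E = rank`
(control, `selmerCorank_le_order_charGenerator`, Kummer) with Greenberg's
`ord_T f_E = rank X/TX ↔ ker T² = ker T` (`order_charGenerator_eq_coinvariantsRank_iff`, PROVED)
forces semisimplicity — at cofinitely many, hence infinitely many, good ordinary `p`
(`infinite_goodOrdinaryPrimes_holds`).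
-/

noncomputable section

set_option linter.dupNamespace false

namespace Summit.BirchSwinnertonDyer.BirchSwinnertonDyer.Cruxes.PinchPrime.FirstLayerStability

open scoped MatrixGroups ModularForm
open CongruenceSubgroup Literature.NumberTheory.EllipticCurves
  Literature.NumberTheory.EllipticCurves.ModularForms
open Summit.BirchSwinnertonDyer.BirchSwinnertonDyer.Theses
open Summit.BirchSwinnertonDyer.BirchSwinnertonDyer.Theorems.PinchPrime.Negative

/-- **The line's open stubs in analytic rank zero** (stub `stub_openStubs_of_L_one_ne_zero` of
crux `PinchPrime`, line `SketchIdeator2`). Assume modularity, BCS and the control fact. Let `E/ℚ`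
be elliptic with globally minimal `W`, assume Kato's finiteness theorem for `W` at every prime,
and `L(E, 1) ≠ 0`. Then (A) `Ш(E/ℚ)[p^∞]` is finite for every good ordinary `p` (outside `∅`),
and (B) outside every finite set there is a good ordinary `p ≥ 5` with a cyclotomic
`ℤ_p`-extension `κ` and a normalised topological generator `γ` such that `ker T² = ker T` on
`ℚ_p ⊗ X(E/ℚ_∞)` for every Iwasawa datum. [cite: Kato2004Asterisque, Cor. 14.3 (p. 235)]
[cite: GreenbergLNM1716, §1 p. 9 (after Conj. 1.12)] -/
theorem stub_openStubs_of_L_one_ne_zero :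
    exists_isNewformOf → burungale_castella_skinner_charIdeal_eq_padicLFunction →
    Greenberg1999_coinvariantsRank_eq_selmerCorank_rat →
    ∀ (W : WeierstrassCurve ℚ) [W.IsElliptic] [W.IsGloballyMinimal],
      (∀ (p : ℕ) [Fact p.Prime], kato_finite_of_L_one_ne_zero W p) →
      W.entireLFunction 1 ≠ 0 →
      (∃ B : Finset ℕ, ∀ p ∉ B, ∀ [Fact p.Prime], IsOrdinaryAt W p →
        Finite (AddCommGroup.primaryComponent W.sha p)) ∧
      (∀ B : Finset ℕ, ∃ p ∉ B, ∃ _ : Fact p.Prime, 5 ≤ p ∧ IsOrdinaryAt W p ∧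
        ∃ (κ : ZpExtension ℚ p) (γ : Field.absoluteGaloisGroup ℚ),
          κ.IsCyclotomic ∧ κ.IsTopGenerator γ ∧ IsCyclotomicVariable p γ ∧
          ∀ D : W.SelmerDualData κ γ,
            LinearMap.ker (IwasawaAlgebra.mulTRat p D.X ∘ₗ IwasawaAlgebra.mulTRat p D.X)
              = LinearMap.ker (IwasawaAlgebra.mulTRat p D.X)) := by
  intro hmod hBCS hcontrol W _ _ hKato hL
  refine ⟨⟨∅, fun p _ _ _ ↦ (hKato p hL).2.1⟩, fun B ↦ ?_⟩
  -- rank zero and analytic rank zero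
  haveI : Finite W.toAffine.Point := (hKato 2 hL).1
  have h0 : W.mordellWeilRank = 0 := W.mordellWeilRank_eq_zero_of_finite
  have han : W.analyticRank = 0 := analyticRank_eq_zero_of_entireLFunction_one_ne_zero W hL
  -- the exceptional sets and a good ordinary prime above them
  obtain ⟨B₂, hB₂⟩ := stub_cofiniteIMC hBCS W
  obtain ⟨B₃, hB₃⟩ := stub_cofiniteTorsion hBCS W
  obtain ⟨p, ⟨hp, hgood, hnd⟩, hgt⟩ :=
    (WeierstrassCurve.infinite_goodOrdinaryPrimes_holds W).exists_gt ((B ∪ B₂ ∪ B₃).sup id + 4)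
  haveI : Fact p.Prime := hp
  have hnot : ∀ {s : Finset ℕ}, s ⊆ B ∪ B₂ ∪ B₃ → p ∉ s := fun {s} hs hps ↦ by
    have hle : p ≤ (B ∪ B₂ ∪ B₃).sup id := Finset.le_sup (f := id) (hs hps)
    omega
  have hpB : p ∉ B := hnot (Finset.subset_union_left.trans Finset.subset_union_left)
  have hp2 : p ∉ B₂ := hnot (Finset.subset_union_right.trans Finset.subset_union_left)
  have hp3 : p ∉ B₃ := hnot Finset.subset_union_right
  have h5 : 5 ≤ p := by omega
  have hord : IsOrdinaryAt W p := ⟨hgood, hnd⟩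
  -- the cyclotomic datum and the newform
  obtain ⟨κ, hκ, γ, hγ, hγ'⟩ := exists_isCyclotomic_isTopGenerator_isCyclotomicVariable_holds p
  haveI : NeZero (W.conductorNorm ℤ) := ⟨(WeierstrassCurve.conductorNorm_pos_holds (W := W)).ne'⟩
  obtain ⟨f, hf⟩ := hmod W
  -- `ord_T L_p = rank (= 0)` at `p` by the interpolation property
  have hLp : (padicLFunction f (unitRoot W p : ℚ_[p])).order = W.mordellWeilRank :=
    (pinch_iff_analyticRank_eq_zero_of_rank_eq_zero W h0 p hord hf).mpr han
  refine ⟨p, hpB, hp, h5, hord, κ, γ, hκ, hγ, hγ', fun D ↦ ?_⟩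
  haveI : Module.Finite (IwasawaAlgebra p) D.X := D.module_finite_of_isCyclotomic W κ hκ hγ
  obtain ⟨fE, hfE⟩ : ∃ fE : IwasawaAlgebra p, D.charIdeal = Ideal.span {fE} := by
    have hP : (D.charIdeal).IsPrincipal := charIdeal_isPrincipal_holds p D.X
    exact ⟨hP.generator, (Ideal.span_singleton_generator D.charIdeal).symm⟩
  have htors : D.IsTorsion := hB₃ p hp3 h5 hord κ γ hκ hγ hγ' f hf D
  -- the main conjecture (cofinitely): `ord_T f_E = ord_T L_p = rank`
  have horder : fE.order = W.mordellWeilRank := by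
    rw [← hB₂ p hp2 h5 hord κ γ hκ hγ hγ' D fE hfE f hf, hLp]
  -- the corank squeeze forces semisimplicity
  have hle1 : (W.selmerCorank p : ℕ∞) ≤ fE.order :=
    selmerCorank_le_order_charGenerator hcontrol W p hord.1 hord.2 hκ hγ D htors hfE
  rw [horder, Nat.cast_le] at hle1
  have h3 : W.selmerCorank p = W.mordellWeilRank + W.shaCorank p :=
    W.selmerCorank_eq_mordellWeilRank_add_holds p
  have hsel : W.selmerCorank p = W.mordellWeilRank := by omega
  obtain ⟨-, h2⟩ := hcontrol W p hord.1 hord.2 κ γ hκ hγ D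
  have hco : fE.order = (IwasawaAlgebra.coinvariantsRank p D.X : ℕ∞) := by
    rw [h2, hsel, horder]
  exact (IwasawaAlgebra.order_charGenerator_eq_coinvariantsRank_iff p htors fE hfE).mp hco

end Summit.BirchSwinnertonDyer.BirchSwinnertonDyer.Cruxes.PinchPrime.FirstLayerStability

end
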